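import Summits.BirchSwinnertonDyer.BirchSwinnertonDyer.Theses.TangentCone
import Summits.BirchSwinnertonDyer.BirchSwinnertonDyer.Theorems.TangentConeEdgeDecayOfCycOrderAllBranches
import HarnessLib

/-!
# Crux `EdgeDecay` (stmt-BirchSwinnertonDyer-17608) — line `lambda-layer-one` (lead skeleton v13)

Line lead `prover-line-stmt-BirchSwinnertonDyer-17608-c1-0` (continuation of lead `-0`), picked line
`Sketch-lambda-layer-one` (idea card `Cruxes/EdgeDecay/Ideas/lambda-layer-one.md`). The crux — at ONE admissible
prime the edge critical-value ratios of the Hida branch through `f_E` decay `p`-adically at rate `≤ r_an` — is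
composed BY NAME (`EdgeDecay_of`).

**v11/v12 = the fact-health repair of v10.** v10 was closed modulo C⁰ + modularity + the named fact
`greenbergStevens_kitagawa_ratio_interpolation`, which the literature-prover flagged MIS-STATED (one trivial-branch
series read at off-branch points) and which cannot be re-threaded through its corrected trivial-branch form because
the crux's `∀ odd j ∈ [3, 2J+1]` always contains `j = 3`, off-branch for every `p ≥ 5` (eread Reader3, 12:34Z). v11
replaces it by the ALL-BRANCHES value–norm fact (stub 3; Literature p163226 ACCEPTED 13:3xZ, the verbatim generalisation of
the tree's `greenbergStevens_kitagawa_twoVariable_interpolation` to every even Teichmüller branch — Delbourgo 2008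
Thm 4.11 with `ψ = 𝟙` is printed for every `j ∈ {0,…,k-2}`) plus Hida's members (stub 4, a tree named fact), and
re-proves the bridge RATIO-FREE (stub 6): the lower bound needs `F_0(x_k, y_s)` from below (stub 5, landed analysis)
and only `‖F_c(x_k, y_j)‖ ≤ 1` (integrality) for the denominators.

Stubs: 1 `stub_cycOrderLeRankSomewhere` (C⁰, conjecture-grade — THE BET, unchanged since v10); 2 `stub_modularity`
(= named fact `exists_isNewformOf`); 3 `stub_gsAllBranches` (= named fact
`Literature.NumberTheory.EllipticCurves.greenbergStevens_kitagawa_twoVariable_interpolation_allBranches`, p163226 ACCEPTED;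
v12 = v11 re-pointed from the local verbatim copy to the Literature name); 4 `stub_hidaMembers` (= named fact
`hida_exists_congruent_ordinary_newform`); 5 `stub_twoVarLowerBound` (theorem-grade, LANDED p163323:
Theorems/TangentConeEdgeDecayStubTwoVarLowerBound.lean); 6 `stub_edgeDecay_of_cycOrderLeRank_allBranches` (the bridge, LANDED
p164153: Theorems/TangentConeEdgeDecayOfCycOrderAllBranches.lean). v13: stubs 5–6 discharged by the tree theorems; the line is
CLOSED MODULO stub 1 (C⁰, conjecture-grade) and the named facts 2–4.
Disproof.lean (cdisprove v2 @dc9456e7) read: F0 wall, F3 (big-image hypothesis used through EdgeDecay's own admissible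
prime), F5 traps respected by the bridge (`k ≥ 5J+8 > 4J+2`, `s` odd, `Λ(g_k,j) ≠ 0` from `2j+2 < k`), §5 no Targets.
-/

-- `Summit.BirchSwinnertonDyer.BirchSwinnertonDyer.…`: the summit and its single sub-problem share a name (D-0017 layout).
set_option linter.dupNamespace false

namespace Summit.BirchSwinnertonDyer.BirchSwinnertonDyer.Cruxes.EdgeDecay.LambdaLayerOne

open scoped Classical
open Filter Topology

/-- **Stub 1 — C⁰ `CycOrderLeRankSomewhere`** (conjecture-grade; the line's bet in its WEAKEST form, unchanged since
v10): for `E` of analytic rank `≥ 2` with a big-image good ordinary prime there is an ADMISSIBLE prime `p` (good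
ordinary, `a_p² ≢ 1 (mod p)`, `ρ̄` surjective, (Br)) with `ord_T L_p(f_E, α; T) ≤ r_an` for the newform `f_E` — the
`≤` half of the Mazur–Tate–Teitelbaum order conjecture at ONE prime of our choosing (implies UB at `p` by Kato; the
card's C⁺ — a unit level-`p²` Riemann sum — is a decidable sufficient criterion, tree theorem
`lambdaLayerOne_cycOrderLeRank_of_layerOneUnit`). [cite: MazurTateTeitelbaum1986Invent, §I.13] -/
theorem stub_cycOrderLeRankSomewhere :
    ∀ (W : WeierstrassCurve ℚ) [W.IsElliptic] [W.IsGloballyMinimal], 2 ≤ W.analyticRank → (∃ (p₀ : ℕ) (_ : Fact p₀.Prime), 5 ≤ p₀ ∧ W.HasGoodReductionAtPrime p₀ ∧ ¬ (p₀ : ℤ) ∣ W.frobeniusTrace p₀ ∧ W.HasSurjectiveModNGaloisRep p₀) → ∃ (_ : NeZero (W.conductorNorm ℤ)) (p : ℕ) (_ : Fact p.Prime), 5 ≤ p ∧ W.HasGoodReductionAtPrime p ∧ ¬ (p : ℤ) ∣ W.frobeniusTrace p ∧ ¬ (p : ℤ) ∣ (W.frobeniusTrace p) ^ 2 - 1 ∧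 W.HasSurjectiveModNGaloisRep p ∧ (∀ (M : ℕ) (_ : NeZero M) (g : CuspForm (CongruenceSubgroup.Gamma0 M) 2) (ι : Literature.NumberTheory.EllipticCurves.ModularForms.coeffField g →+* PadicAlgCl p), M ∣ W.conductorNorm ℤ * p → Literature.NumberTheory.EllipticCurves.ModularForms.IsNewform0 g → ‖ι ⟨(UpperHalfPlane.qExpansion 1 ⇑g).coeff p, Literature.NumberTheory.EllipticCurves.ModularForms.coeff_mem_coeffField g p⟩‖ = 1 → (∀ ℓ : ℕ, ℓ.Prime → ¬ ℓ ∣ W.conductorNorm ℤ * p → ‖ι ⟨(UpperHalfPlane.qExpansion 1 ⇑g).coeff ℓ, Literature.NumberTheory.EllipticCurves.ModularForms.coeff_mem_coeffField g ℓ⟩ - ((W.frobeniusTrace ℓ : ℤ) : PadicAlgCl p)‖ < 1) → M = W.conductorNorm ℤ ∧ ∀ n : ℕ, (UpperHalfPlane.qExpansion 1 ⇑g).coeff n = ((W.LFunction n : ℤ) : ℂ)) ∧ ∀ (f : CuspForm (CongruenceSubgroup.Gamma0 (W.conductorNorm ℤ)) 2), Literature.NumberTheory.EllipticCurves.ModularForms.IsNewformOf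 W f → (Literature.NumberTheory.EllipticCurves.padicLFunction f (Literature.NumberTheory.EllipticCurves.unitRoot W p : ℚ_[p])).order ≤ W.analyticRank := by
  sorry

/-- **Stub 2 — modularity** (the named fact `exists_isNewformOf`; Wiles–BCDT). [cite: DiamondShurman2005, Thm. 8.8.3] -/
theorem stub_modularity :
    Literature.NumberTheory.EllipticCurves.ModularForms.exists_isNewformOf := by
  sorry

/-- **Stub 3 — Greenberg–Stevens / Kitagawa value–norm interpolation on ALL even Teichmüller branches** (fact-grade;
= Literature p163226, ACCEPTED). [cite: GreenbergStevens1993, Thm 5.15] [cite: Delbourgo2008, Thm 4.11, Def. 4.12, p. 100] -/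
theorem stub_gsAllBranches :
    Literature.NumberTheory.EllipticCurves.greenbergStevens_kitagawa_twoVariable_interpolation_allBranches := by
  sorry

/-- **Stub 4 — Hida's classical members of the branch** (fact-grade; the tree's named fact). [cite: Hida1986] -/
theorem stub_hidaMembers :
    Literature.NumberTheory.EllipticCurves.hida_exists_congruent_ordinary_newform := by
  sorry

/-- **Stub 5 — lower bound along a lattice curve from a non-zero axis coefficient** (theorem-grade, elementary
`p`-adic analysis; LANDED p163323 as `Theorems.stub_twoVarLowerBound`, from the landed sub-lemmas
`stub_lowestFormNonvanishing`, `stub_twoVarDominant`, `stub_normCycPow`). [folklore] -/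
theorem stub_twoVarLowerBound :
    ∀ (p : ℕ) [Fact p.Prime], p ≠ 2 → ∀ (F : ℕ → ℕ → ℚ_[p]) (M : ℝ) (n : ℕ), (∀ i j : ℕ, ‖F i j‖ ≤ M) →
      (∃ j : ℕ, j ≤ n ∧ F 0 j ≠ 0) → ∃ a b : ℕ, 0 < b ∧ 2 * a < b ∧ ∃ m₀ C : ℕ, ∀ t : ℕ, 0 < t →
        m₀ ≤ padicValNat p t →
          1 ≤ ‖∑' q : ℕ × ℕ, F q.1 q.2 * (((1 + p : ℕ) : ℚ_[p]) ^ (t * b) - 1) ^ q.1 *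
                (((1 + p : ℕ) : ℚ_[p]) ^ (t * a) - 1) ^ q.2‖ * (p : ℝ) ^ (n * (padicValNat p t + 1) + C) :=
  Summit.BirchSwinnertonDyer.BirchSwinnertonDyer.Theorems.stub_twoVarLowerBound

/-- **Stub 6 — the ratio-free bridge from the logical core** (theorem-grade; LANDED p164153 as
`Theorems.stub_edgeDecay_of_cycOrderLeRank_allBranches`): C⁰ → modularity → GS all-branches → Hida members → `EdgeDecay`.
[folklore] -/
theorem stub_edgeDecay_of_cycOrderLeRank_allBranches :
    (∀ (W : WeierstrassCurve ℚ) [W.IsElliptic] [W.IsGloballyMinimal], 2 ≤ W.analyticRank → (∃ (p₀ : ℕ) (_ : Fact p₀.Prime), 5 ≤ p₀ ∧ W.HasGoodReductionAtPrime p₀ ∧ ¬ (p₀ : ℤ) ∣ W.frobeniusTrace p₀ ∧ W.HasSurjectiveModNGaloisRep p₀) → ∃ (_ : NeZero (W.conductorNorm ℤ)) (p : ℕ) (_ : Fact p.Prime), 5 ≤ p ∧ W.HasGoodReductionAtPrime p ∧ ¬ (p : ℤ) ∣ W.frobeniusTrace p ∧ ¬ (p : ℤ) ∣ (W.frobeniusTrace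 p) ^ 2 - 1 ∧ W.HasSurjectiveModNGaloisRep p ∧ (∀ (M : ℕ) (_ : NeZero M) (g : CuspForm (CongruenceSubgroup.Gamma0 M) 2) (ι : Literature.NumberTheory.EllipticCurves.ModularForms.coeffField g →+* PadicAlgCl p), M ∣ W.conductorNorm ℤ * p → Literature.NumberTheory.EllipticCurves.ModularForms.IsNewform0 g → ‖ι ⟨(UpperHalfPlane.qExpansion 1 ⇑g).coeff p, Literature.NumberTheory.EllipticCurves.ModularForms.coeff_mem_coeffField g p⟩‖ = 1 → (∀ ℓ : ℕ, ℓ.Prime → ¬ ℓ ∣ W.conductorNorm ℤ * p → ‖ι ⟨(UpperHalfPlane.qExpansion 1 ⇑g).coeff ℓ, Literature.NumberTheory.EllipticCurves.ModularForms.coeff_mem_coeffField g ℓ⟩ - ((W.frobeniusTrace ℓ : ℤ) : PadicAlgCl p)‖ < 1) → M = W.conductorNorm ℤ ∧ ∀ n : ℕ, (UpperHalfPlane.qExpansion 1 ⇑g).coeff n = ((W.LFunction n : ℤ) : ℂ)) ∧ ∀ (f : CuspForm (CongruenceSubgroup.Gamma0 (W.conductorNorm ℤ)) 2), Literature.NumberTheory.EllipticCurves.ModularForms.IsNewformOf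 W f → (Literature.NumberTheory.EllipticCurves.padicLFunction f (Literature.NumberTheory.EllipticCurves.unitRoot W p : ℚ_[p])).order ≤ W.analyticRank) → Literature.NumberTheory.EllipticCurves.ModularForms.exists_isNewformOf → Literature.NumberTheory.EllipticCurves.greenbergStevens_kitagawa_twoVariable_interpolation_allBranches → Literature.NumberTheory.EllipticCurves.hida_exists_congruent_ordinary_newform → Summit.BirchSwinnertonDyer.BirchSwinnertonDyer.Theses.TangentCone.EdgeDecay :=
  Summit.BirchSwinnertonDyer.BirchSwinnertonDyer.Theorems.stub_edgeDecay_of_cycOrderLeRank_allBranches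

/-- **Composition**: the crux `EdgeDecay` BY NAME from the registered stubs (stub 6 applied to stubs 1–4; stub 5 is
consumed inside stub 6's proof). -/
theorem EdgeDecay_of : Summit.BirchSwinnertonDyer.BirchSwinnertonDyer.Theses.TangentCone.EdgeDecay :=
  stub_edgeDecay_of_cycOrderLeRank_allBranches stub_cycOrderLeRankSomewhere stub_modularity stub_gsAllBranches
    stub_hidaMembers

end Summit.BirchSwinnertonDyer.BirchSwinnertonDyer.Cruxes.EdgeDecay.LambdaLayerOne
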